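import Summits.QuantumFields.YangMills.Theses.IsotropyFromPowerCounting
import Summits.QuantumFields.YangMills.Theorems.MirrorModularBoostsCurvatureBoostCovarianceDominatedTieLimitRiemannSum

/-!
# Degree two of `TemperedCurvatureMoments` is the kernel triple

Support file for the item `IsotropyFromPowerCounting.TemperedCurvatureMoments` (T, stmt-QuantumFields-17721); lead c5 of
crux stmt-QuantumFields-14999 (`MirrorModularBoosts.SoftKernelBoostCovariance`, line `Sketch`), third T-side file after
`…OfBddRenormalisation.lean` (T ⇐ tempered TRUE Wilson densities; T for `sup |c_k| < ∞`) and `…OrderZero.lean`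
(order zero for bounded renormalisation; degree one of T along every tied scheme).

Here: the degree-two layer of T carries no content beyond the KERNEL TRIPLE of the crux (the conclusion of
`CurvatureKernelBound`, stmt-11687): if `S₁ 2 F = ∫ K(x₀ − x₁) F(x) dx` on `⁰𝒮₂` with `K` real, continuous off `0` and
`|K(x)| ≤ C (1 + ‖x‖^{η−10})`, `η > 0`, then along ANY scheme (`a_k → 0⁺`, `a_k L_k → ∞`) the lattice densities
`D_k(x) := K(a_k x₀ − a_k x₁)` are tempered at injective multi-sites (`kernel_tempered`) and their Riemann sums converge to
`S₁ 2` on off-diagonal real tensors (`tendsto_riemannSum_piBox` of the sibling line, applied to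
`y ↦ f₀(y₀) f₁(y₁) K(y₀ − y₁)`, which is bounded by `(1 + ‖y‖)⁻⁹` because the tensor is FLAT on the diagonal —
`IsOffDiagonal.one_add_norm_pow_mul_norm_le_sub` — exactly where `K` is singular, and continuous off the null coincidence
locus).  No tie, no lattice, no gauge group is used: `temperedCurvatureMoments_two_of_kernel`.

With `temperedCurvatureMoments_one` (degree one, every tied scheme) this leaves as the genuine Yang–Mills content of T the
degrees `n ≥ 3` in the regime `sup_k |c_k| = ∞`.

References: Osterwalder–Schrader 1973 §2 (`⁰𝒮`); Glimm–Jaffe 1987 §9.5–9.6 (lattice approximation, Riemann sums).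
-/

noncomputable section

open scoped SchwartzMap BigOperators
open MeasureTheory Filter Topology
open Literature.MathematicalPhysics.QuantumFieldTheory Literature.MathematicalPhysics.QuantumLattice
open Literature.MathematicalPhysics.AQFT
open Literature.Probability.LatticeModels (box Site)
open Summit.QuantumFields.YangMills.Theorems.CurvatureBoostCovariance.BoostsInheritMirrors.DominatedTieLimit
  (tendsto_riemannSum_piBox volume_coincidenceLocus)
open Summit.QuantumFields.YangMills.Theorems.NPointIsotropy.Negative (E4)

namespace Summit.QuantumFields.YangMills.Theorems.SoftKernelBoostCovariance.Sketch

namespace DegreeTwo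

/-! ## The soft kernel is a tempered weight -/

/-- **A soft kernel is tempered in the pair variables.**  If `|K(w)| ≤ C(1 + ‖w‖^{η−10})` for `w ≠ 0` (`η > 0`) then
`|K(y₀ − y₁)| ≤ C' (1 + ‖y‖)^N (1 + ‖y₀ − y₁‖⁻¹)^N` for all `y : Fin 2 → ℝ⁴` off the diagonal
(`N = ⌈η⌉₊ + 10`: the singularity at `0` is at most `‖w‖⁻¹⁰`, the growth at infinity at most `‖w‖^{⌈η⌉}`). -/
theorem kernel_tempered (K : E4 → ℝ) (C η : ℝ) (hη : 0 < η)
    (hK : ∀ w : E4, w ≠ 0 → |K w| ≤ C * (1 + ‖w‖ ^ (η - 10))) :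
    ∃ (C' : ℝ) (N : ℕ), 0 < C' ∧ ∀ y : Fin 2 → E4, y 0 ≠ y 1 →
      |K (y 0 - y 1)| ≤ C' * (1 + ‖y‖) ^ N * (1 + ‖y 0 - y 1‖⁻¹) ^ N := by
  -- `C ≥ 0` (test the bound at any non-zero vector)
  have hC0 : 0 ≤ C := by
    have hw : (EuclideanSpace.single (0 : Fin 4) (1 : ℝ) : E4) ≠ 0 := by
      intro h; simpa using congrArg (fun v : E4 => v 0) h
    have h := hK _ hw
    have hpos : 0 < 1 + ‖(EuclideanSpace.single (0 : Fin 4) (1 : ℝ) : E4)‖ ^ (η - 10) := by positivity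
    nlinarith [abs_nonneg (K (EuclideanSpace.single (0 : Fin 4) (1 : ℝ)))]
  set N₁ : ℕ := ⌈η⌉₊ with hN₁
  refine ⟨(C + 1) * (2 + 2 ^ N₁), N₁ + 10, by positivity, fun y hy => ?_⟩
  set w : E4 := y 0 - y 1 with hw
  have hw0 : w ≠ 0 := sub_ne_zero.2 hy
  have hr : 0 < ‖w‖ := norm_pos_iff.2 hw0
  have hKw := hK w hw0
  have hy1 : 1 ≤ 1 + ‖y‖ := le_add_of_nonneg_right (norm_nonneg _)
  have hs1 : 1 ≤ 1 + ‖w‖⁻¹ := le_add_of_nonneg_right (inv_nonneg.2 (norm_nonneg _))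
  have hP : 1 ≤ (1 + ‖y‖) ^ (N₁ + 10) * (1 + ‖w‖⁻¹) ^ (N₁ + 10) :=
    one_le_mul_of_one_le_of_one_le (one_le_pow₀ hy1) (one_le_pow₀ hs1)
  -- the power `‖w‖^(η-10)` against the tempered weight
  have hpow : ‖w‖ ^ (η - 10) ≤ 2 ^ N₁ * (1 + ‖y‖) ^ (N₁ + 10) * (1 + ‖w‖⁻¹) ^ (N₁ + 10) := by
    rcases le_or_gt ‖w‖ 1 with hle | hgt
    · -- near the diagonal: `‖w‖^(η-10) ≤ ‖w‖^(-10) = (‖w‖⁻¹)^10 ≤ (1 + ‖w‖⁻¹)^10`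
      have h1 : ‖w‖ ^ (η - 10) ≤ ‖w‖ ^ (-(10 : ℝ)) :=
        Real.rpow_le_rpow_of_exponent_ge hr hle (by linarith)
      have h2 : ‖w‖ ^ (-(10 : ℝ)) = (‖w‖⁻¹) ^ (10 : ℕ) := by
        rw [Real.rpow_neg hr.le, ← Real.inv_rpow hr.le]
        exact_mod_cast Real.rpow_natCast ‖w‖⁻¹ 10
      have h3 : (‖w‖⁻¹) ^ (10 : ℕ) ≤ (1 + ‖w‖⁻¹) ^ (10 : ℕ) :=
        pow_le_pow_left₀ (inv_nonneg.2 hr.le) (le_add_of_nonneg_left zero_le_one) 10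
      have h4 : (1 + ‖w‖⁻¹) ^ (10 : ℕ) ≤ (1 + ‖w‖⁻¹) ^ (N₁ + 10) := pow_le_pow_right₀ hs1 (by omega)
      have h5 : (1 + ‖w‖⁻¹) ^ (N₁ + 10) ≤ 2 ^ N₁ * (1 + ‖y‖) ^ (N₁ + 10) * (1 + ‖w‖⁻¹) ^ (N₁ + 10) := by
        have : 1 ≤ 2 ^ N₁ * (1 + ‖y‖) ^ (N₁ + 10) :=
          one_le_mul_of_one_le_of_one_le (one_le_pow₀ (by norm_num)) (one_le_pow₀ hy1)
        exact le_mul_of_one_le_left (by positivity) this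
      linarith [h1, h2.le, h2.ge, h3, h4, h5]
    · -- far from the diagonal: `‖w‖^(η-10) ≤ ‖w‖^N₁ ≤ (2(1+‖y‖))^N₁`
      have h1 : ‖w‖ ^ (η - 10) ≤ ‖w‖ ^ (N₁ : ℝ) :=
        Real.rpow_le_rpow_of_exponent_le hgt.le (by linarith [Nat.le_ceil η])
      have h2 : ‖w‖ ^ (N₁ : ℝ) = ‖w‖ ^ N₁ := Real.rpow_natCast _ _
      have hwy : ‖w‖ ≤ 2 * (1 + ‖y‖) := by
        calc ‖w‖ ≤ ‖y 0‖ + ‖y 1‖ := norm_sub_le _ _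
          _ ≤ ‖y‖ + ‖y‖ := add_le_add (norm_le_pi_norm y 0) (norm_le_pi_norm y 1)
          _ ≤ 2 * (1 + ‖y‖) := by linarith [norm_nonneg y]
      have h3 : ‖w‖ ^ N₁ ≤ 2 ^ N₁ * (1 + ‖y‖) ^ N₁ := by
        rw [← mul_pow]; exact pow_le_pow_left₀ hr.le hwy N₁
      have h4 : (1 + ‖y‖) ^ N₁ ≤ (1 + ‖y‖) ^ (N₁ + 10) * (1 + ‖w‖⁻¹) ^ (N₁ + 10) :=
        (pow_le_pow_right₀ hy1 (by omega)).trans (le_mul_of_one_le_right (by positivity) (one_le_pow₀ hs1))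
      calc ‖w‖ ^ (η - 10) ≤ ‖w‖ ^ N₁ := h1.trans h2.le
        _ ≤ 2 ^ N₁ * (1 + ‖y‖) ^ N₁ := h3
        _ ≤ 2 ^ N₁ * ((1 + ‖y‖) ^ (N₁ + 10) * (1 + ‖w‖⁻¹) ^ (N₁ + 10)) :=
            mul_le_mul_of_nonneg_left h4 (by positivity)
        _ = 2 ^ N₁ * (1 + ‖y‖) ^ (N₁ + 10) * (1 + ‖w‖⁻¹) ^ (N₁ + 10) := by ring
  calc |K w| ≤ C * (1 + ‖w‖ ^ (η - 10)) := hKw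
    _ ≤ C * ((1 + ‖y‖) ^ (N₁ + 10) * (1 + ‖w‖⁻¹) ^ (N₁ + 10) +
          2 ^ N₁ * (1 + ‖y‖) ^ (N₁ + 10) * (1 + ‖w‖⁻¹) ^ (N₁ + 10)) :=
        mul_le_mul_of_nonneg_left (add_le_add hP hpow) hC0
    _ = C * (1 + 2 ^ N₁) * ((1 + ‖y‖) ^ (N₁ + 10) * (1 + ‖w‖⁻¹) ^ (N₁ + 10)) := by ring
    _ ≤ (C + 1) * (2 + 2 ^ N₁) * ((1 + ‖y‖) ^ (N₁ + 10) * (1 + ‖w‖⁻¹) ^ (N₁ + 10)) := by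
        refine mul_le_mul_of_nonneg_right ?_ (by positivity)
        nlinarith [pow_nonneg (zero_le_two : (0 : ℝ) ≤ 2) N₁]
    _ = (C + 1) * (2 + 2 ^ N₁) * (1 + ‖y‖) ^ (N₁ + 10) * (1 + ‖w‖⁻¹) ^ (N₁ + 10) := by ring

/-! ## The Riemann integrand `f₀(y₀) f₁(y₁) K(y₀ − y₁)` -/

/-- **Decay of the degree-two integrand.**  For an off-diagonal tensor `F = f₀ ⊗ f₁` of real test functions and a soft
kernel `K`, the function `y ↦ f₀(y₀) f₁(y₁) K(y₀ − y₁)` is `O((1 + ‖y‖)⁻⁹)`: near the diagonal the flatness of `F`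
(order `10`) beats the singularity `‖y₀ − y₁‖⁻¹⁰` of `K`, away from it the Schwartz decay of `F` beats the polynomial
growth of `K`; on the diagonal the integrand vanishes (`f₀(p) f₁(p) = F(p,p) = 0`). -/
theorem integrand_decay (K : E4 → ℝ) (C η : ℝ) (hη : 0 < η)
    (hK : ∀ w : E4, w ≠ 0 → |K w| ≤ C * (1 + ‖w‖ ^ (η - 10)))
    (f : Fin 2 → 𝓢(E4, ℝ)) (F : 𝓢((Fin 2 → E4), ℂ)) (hF : IsTensorOf F (fun i => ofRealTest (f i)))
    (hF' : IsOffDiagonal F) :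
    ∃ K' : ℝ, ∀ y : Fin 2 → E4,
      ‖f 0 (y 0) * f 1 (y 1) * K (y 0 - y 1)‖ ≤ K' * ((1 + ‖y‖) ^ 9)⁻¹ := by
  have hC0 : 0 ≤ C := by
    have hw : (EuclideanSpace.single (0 : Fin 4) (1 : ℝ) : E4) ≠ 0 := by
      intro h; simpa using congrArg (fun v : E4 => v 0) h
    have h := hK _ hw
    have hpos : 0 < 1 + ‖(EuclideanSpace.single (0 : Fin 4) (1 : ℝ) : E4)‖ ^ (η - 10) := by positivity
    nlinarith [abs_nonneg (K (EuclideanSpace.single (0 : Fin 4) (1 : ℝ)))]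
  set N₁ : ℕ := ⌈η⌉₊ with hN₁
  -- the two Schwartz constants
  set S₁₀ : ℝ := schwartzNorm 10 F with hS₁₀
  set Sk : ℝ := (Finset.Iic (9 + N₁, 0)).sup (fun m => SchwartzMap.seminorm ℂ m.1 m.2) F with hSk
  have hS₁₀0 : 0 ≤ S₁₀ := schwartzNorm_nonneg 10 F
  have hSk0 : 0 ≤ Sk := apply_nonneg _ _
  -- `‖F y‖ = |f₀(y₀) f₁(y₁)|`
  have hFy : ∀ y : Fin 2 → E4, ‖F y‖ = ‖f 0 (y 0) * f 1 (y 1)‖ := fun y => by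
    rw [hF y, Fin.prod_univ_two]
    simp [ofRealTest_apply]
  refine ⟨2 * C * 4 ^ 9 * S₁₀ / (9).factorial + 2 ^ (9 + N₁) * Sk * (C * (1 + 2 ^ N₁)), fun y => ?_⟩
  have hy1 : 1 ≤ 1 + ‖y‖ := le_add_of_nonneg_right (norm_nonneg _)
  have hy9 : 0 < (1 + ‖y‖) ^ 9 := by positivity
  have hA0 : 0 ≤ 2 * C * 4 ^ 9 * S₁₀ / (9).factorial := by positivity
  have hB0 : 0 ≤ 2 ^ (9 + N₁) * Sk * (C * (1 + 2 ^ N₁)) := by positivity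
  rw [← div_eq_mul_inv, le_div_iff₀ hy9]
  by_cases hdiag : y 0 = y 1
  · -- on the diagonal the tensor vanishes
    have hmem : y ∈ coincidenceLocus 2 E4 := ⟨0, 1, by decide, hdiag⟩
    have h0 : ‖f 0 (y 0) * f 1 (y 1)‖ = 0 := by rw [← hFy, hF'.apply_eq_zero hmem, norm_zero]
    rw [norm_mul, h0, zero_mul, zero_mul]
    positivity
  set w : E4 := y 0 - y 1 with hw
  have hw0 : w ≠ 0 := sub_ne_zero.2 hdiag
  have hr : 0 < ‖w‖ := norm_pos_iff.2 hw0
  have hKw := hK w hw0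
  rcases le_or_gt ‖w‖ 1 with hle | hgt
  · -- near the diagonal: flatness of order 10 against `‖w‖⁻¹⁰`
    have hflat : (1 + ‖y‖) ^ 9 * ‖F y‖ ≤ 4 ^ 9 * S₁₀ * ‖y 0 - y 1‖ ^ (9 + 1) / (9).factorial :=
      hF'.one_add_norm_pow_mul_norm_le_sub (a := 1) (b := 0) (by decide) (by simpa [hw] using hle)
        (k := 9) (M := 9) (m := 10) (by norm_num) (by norm_num)
    have hKle : |K w| ≤ 2 * C * (‖w‖ ^ (10 : ℕ))⁻¹ := by
      have h1 : ‖w‖ ^ (η - 10) ≤ ‖w‖ ^ (-(10 : ℝ)) :=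
        Real.rpow_le_rpow_of_exponent_ge hr hle (by linarith)
      have h2 : ‖w‖ ^ (-(10 : ℝ)) = (‖w‖ ^ (10 : ℕ))⁻¹ := by
        rw [Real.rpow_neg hr.le]
        exact_mod_cast congrArg Inv.inv (Real.rpow_natCast ‖w‖ 10)
      have h3 : 1 ≤ (‖w‖ ^ (10 : ℕ))⁻¹ := one_le_inv_iff₀.2 ⟨pow_pos hr _, pow_le_one₀ hr.le hle⟩
      calc |K w| ≤ C * (1 + ‖w‖ ^ (η - 10)) := hKw
        _ ≤ C * ((‖w‖ ^ (10 : ℕ))⁻¹ + (‖w‖ ^ (10 : ℕ))⁻¹) := by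
            refine mul_le_mul_of_nonneg_left (add_le_add h3 ?_) hC0
            exact h1.trans h2.le
        _ = 2 * C * (‖w‖ ^ (10 : ℕ))⁻¹ := by ring
    have hw10 : 0 < ‖w‖ ^ (10 : ℕ) := pow_pos hr _
    have key : ‖f 0 (y 0) * f 1 (y 1) * K (y 0 - y 1)‖ * (1 + ‖y‖) ^ 9 ≤ 2 * C * 4 ^ 9 * S₁₀ / (9).factorial :=
      calc ‖f 0 (y 0) * f 1 (y 1) * K (y 0 - y 1)‖ * (1 + ‖y‖) ^ 9
          = ((1 + ‖y‖) ^ 9 * ‖F y‖) * |K w| := by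
            rw [norm_mul, ← hFy, hw, Real.norm_eq_abs]; ring
        _ ≤ (4 ^ 9 * S₁₀ * ‖y 0 - y 1‖ ^ (9 + 1) / (9).factorial) * (2 * C * (‖w‖ ^ (10 : ℕ))⁻¹) :=
            mul_le_mul hflat hKle (abs_nonneg _) (by positivity)
        _ = 2 * C * 4 ^ 9 * S₁₀ / (9).factorial := by
            rw [← hw]; field_simp; ring
    exact key.trans (le_add_of_nonneg_right hB0)
  · -- far from the diagonal: Schwartz decay of order `9 + N₁` against growth `(1+‖y‖)^N₁`
    have hdec : (1 + ‖y‖) ^ (9 + N₁) * ‖F y‖ ≤ 2 ^ (9 + N₁) * Sk := by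
      have h := SchwartzMap.one_add_le_sup_seminorm_apply (𝕜 := ℂ) (m := (9 + N₁, 0)) (k := 9 + N₁) (n := 0)
        le_rfl le_rfl F y
      rwa [norm_iteratedFDeriv_zero] at h
    have hKle : |K w| ≤ C * (1 + 2 ^ N₁) * (1 + ‖y‖) ^ N₁ := by
      have h1 : ‖w‖ ^ (η - 10) ≤ ‖w‖ ^ (N₁ : ℝ) :=
        Real.rpow_le_rpow_of_exponent_le hgt.le (by linarith [Nat.le_ceil η])
      have h2 : ‖w‖ ^ (N₁ : ℝ) = ‖w‖ ^ N₁ := Real.rpow_natCast _ _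
      have hwy : ‖w‖ ≤ 2 * (1 + ‖y‖) := by
        calc ‖w‖ ≤ ‖y 0‖ + ‖y 1‖ := norm_sub_le _ _
          _ ≤ ‖y‖ + ‖y‖ := add_le_add (norm_le_pi_norm y 0) (norm_le_pi_norm y 1)
          _ ≤ 2 * (1 + ‖y‖) := by linarith [norm_nonneg y]
      have h3 : ‖w‖ ^ N₁ ≤ 2 ^ N₁ * (1 + ‖y‖) ^ N₁ := by
        rw [← mul_pow]; exact pow_le_pow_left₀ hr.le hwy N₁
      have h4 : 1 ≤ (1 + ‖y‖) ^ N₁ := one_le_pow₀ hy1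
      calc |K w| ≤ C * (1 + ‖w‖ ^ (η - 10)) := hKw
        _ ≤ C * ((1 + ‖y‖) ^ N₁ + 2 ^ N₁ * (1 + ‖y‖) ^ N₁) :=
            mul_le_mul_of_nonneg_left (add_le_add h4 ((h1.trans h2.le).trans h3)) hC0
        _ = C * (1 + 2 ^ N₁) * (1 + ‖y‖) ^ N₁ := by ring
    have key : ‖f 0 (y 0) * f 1 (y 1) * K (y 0 - y 1)‖ * (1 + ‖y‖) ^ 9 ≤ 2 ^ (9 + N₁) * Sk * (C * (1 + 2 ^ N₁)) :=
      calc ‖f 0 (y 0) * f 1 (y 1) * K (y 0 - y 1)‖ * (1 + ‖y‖) ^ 9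
          = ((1 + ‖y‖) ^ 9 * ‖F y‖) * |K w| := by
            rw [norm_mul, ← hFy, hw, Real.norm_eq_abs]; ring
        _ ≤ ((1 + ‖y‖) ^ 9 * ‖F y‖) * (C * (1 + 2 ^ N₁) * (1 + ‖y‖) ^ N₁) :=
            mul_le_mul_of_nonneg_left hKle (by positivity)
        _ = ((1 + ‖y‖) ^ (9 + N₁) * ‖F y‖) * (C * (1 + 2 ^ N₁)) := by rw [pow_add]; ring
        _ ≤ 2 ^ (9 + N₁) * Sk * (C * (1 + 2 ^ N₁)) := mul_le_mul_of_nonneg_right hdec (by positivity)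
    exact key.trans (le_add_of_nonneg_left hA0)

/-- The degree-two integrand is continuous off the coincidence locus, hence almost everywhere. -/
theorem integrand_continuousAt_ae (K : E4 → ℝ) (hKc : ContinuousOn K {x : E4 | x ≠ 0}) (f : Fin 2 → 𝓢(E4, ℝ)) :
    ∀ᵐ z ∂(volume : Measure (Fin 2 → E4)), ContinuousAt (fun y : Fin 2 → E4 => f 0 (y 0) * f 1 (y 1) * K (y 0 - y 1)) z := by
  have hnull := volume_coincidenceLocus 2
  rw [← compl_mem_ae_iff] at hnull
  filter_upwards [hnull] with z hz
  have hz' : z 0 ≠ z 1 := fun h => hz ⟨0, 1, by decide, h⟩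
  have h0 : ContinuousAt (fun y : Fin 2 → E4 => f 0 (y 0)) z :=
    ((f 0).continuous.comp (continuous_apply 0)).continuousAt
  have h1 : ContinuousAt (fun y : Fin 2 → E4 => f 1 (y 1)) z :=
    ((f 1).continuous.comp (continuous_apply 1)).continuousAt
  have hd : Continuous fun y : Fin 2 → E4 => y 0 - y 1 := (continuous_apply 0).sub (continuous_apply 1)
  have hK : ContinuousAt (fun y : Fin 2 → E4 => K (y 0 - y 1)) z := by
    refine ContinuousAt.comp (g := K) ?_ hd.continuousAt
    exact hKc.continuousAt ((isOpen_ne (x := (0 : E4))).mem_nhds (sub_ne_zero.2 hz'))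
  exact (h0.mul h1).mul hK

/-! ## Degree two of T from the kernel triple -/

/-- **DEGREE TWO OF `TemperedCurvatureMoments` IS THE KERNEL TRIPLE.**  Let `S₁` carry the kernel triple of the crux
(`K` real, continuous off `0`, `|K(x)| ≤ C(1 + ‖x‖^{η−10})`, `η > 0`, `S₁ 2 F = ∫ K(x₀ − x₁) F(x) dx` on `⁰𝒮₂`).  Then
along ANY sequential scheme the degree-two conclusion of T holds with the lattice densities `D_k(x) = K(a_k x₀ − a_k x₁)`:
tempered at injective multi-sites by `kernel_tempered`, Riemann sums converging to `S₁ 2 F` on off-diagonal real tensors by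
dominated convergence over the exploding product boxes (`tendsto_riemannSum_piBox`; decay `integrand_decay`, a.e.
continuity `integrand_continuousAt_ae`).  No tie, lattice measure or gauge group enters. -/
theorem temperedCurvatureMoments_two_of_kernel {ι : Type} (sch : SpeciesScheme ι) (S₁ : SchwingerFamily E4)
    (hK : ∃ (K : E4 → ℝ) (C η : ℝ), 0 < η ∧ ContinuousOn K {x : E4 | x ≠ 0} ∧
      (∀ x : E4, x ≠ 0 → |K x| ≤ C * (1 + ‖x‖ ^ (η - 10))) ∧
      ∀ F : SchwartzMap (Fin 2 → E4) ℂ, IsOffDiagonal F →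
        MeasureTheory.Integrable (fun x : Fin 2 → E4 => (K (x 0 - x 1) : ℂ) * F x) ∧
          S₁ 2 F = ∫ x : Fin 2 → E4, (K (x 0 - x 1) : ℂ) * F x) :
    ∃ (D : ℕ → (Fin 2 → Site 4) → ℝ) (C : ℝ) (N k₀ : ℕ), 0 < C ∧
      (∀ k : ℕ, k₀ ≤ k → ∀ x : Fin 2 → Site 4, (∀ i, x i ∈ box 4 (sch.L k)) → Function.Injective x →
        |D k x| ≤ C * (1 + ‖fun i => sch.a k • siteToE (x i)‖) ^ N *
          (1 + ∑ i, ∑ j ∈ Finset.univ.erase i,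
            ‖sch.a k • siteToE (x i) - sch.a k • siteToE (x j)‖⁻¹) ^ N) ∧
      ∀ (f : Fin 2 → SchwartzMap E4 ℝ) (F : SchwartzMap (Fin 2 → E4) ℂ),
        IsTensorOf F (fun i => ofRealTest (f i)) → IsOffDiagonal F →
        Filter.Tendsto (fun k => (((sch.a k ^ 4) ^ 2 *
          ∑ x ∈ Fintype.piFinset (fun _ : Fin 2 => box 4 (sch.L k)),
            (∏ i, f i (sch.a k • siteToE (x i))) * D k x : ℝ) : ℂ)) Filter.atTop (nhds (S₁ 2 F)) := by
  obtain ⟨K, C, η, hη, hKc, hKb, hrep⟩ := hK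
  obtain ⟨C', N, hC', htemp⟩ := kernel_tempered K C η hη hKb
  refine ⟨fun k x => K (sch.a k • siteToE (x 0) - sch.a k • siteToE (x 1)), C', N, 0, hC', ?_, ?_⟩
  · -- tempered at injective multi-sites
    intro k _ x _ hx
    set y : Fin 2 → E4 := fun i => sch.a k • siteToE (x i) with hy
    have hy01 : y 0 ≠ y 1 := by
      intro h
      have h' : siteToE (x 0) = siteToE (x 1) := smul_right_injective E4 (sch.a_pos k).ne' h
      have : x 0 = x 1 := by
        funext i
        have := congrArg (fun v : E4 => v i) h'
        simp only [siteToE_apply, Int.cast_inj] at this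
        exact this
      exact absurd (hx this) (by decide)
    have h := htemp y hy01
    have h1 : ‖y 0 - y 1‖⁻¹ ≤ ∑ j ∈ Finset.univ.erase (0 : Fin 2), ‖y 0 - y j‖⁻¹ :=
      Finset.single_le_sum (f := fun j => ‖y 0 - y j‖⁻¹) (fun j _ => inv_nonneg.2 (norm_nonneg _))
        (Finset.mem_erase.2 ⟨by decide, Finset.mem_univ 1⟩)
    have h2 : ∑ j ∈ Finset.univ.erase (0 : Fin 2), ‖y 0 - y j‖⁻¹ ≤
        ∑ i, ∑ j ∈ Finset.univ.erase i, ‖y i - y j‖⁻¹ :=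
      Finset.single_le_sum (f := fun i => ∑ j ∈ Finset.univ.erase i, ‖y i - y j‖⁻¹)
        (fun i _ => Finset.sum_nonneg fun j _ => inv_nonneg.2 (norm_nonneg _)) (Finset.mem_univ 0)
    have h0 : 0 ≤ 1 + ‖y 0 - y 1‖⁻¹ := by positivity
    have hsum : (1 + ‖y 0 - y 1‖⁻¹) ^ N ≤
        (1 + ∑ i, ∑ j ∈ Finset.univ.erase i, ‖y i - y j‖⁻¹) ^ N :=
      pow_le_pow_left₀ h0 (by linarith) N
    calc |K (sch.a k • siteToE (x 0) - sch.a k • siteToE (x 1))| = |K (y 0 - y 1)| := rfl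
      _ ≤ C' * (1 + ‖y‖) ^ N * (1 + ‖y 0 - y 1‖⁻¹) ^ N := h
      _ ≤ C' * (1 + ‖y‖) ^ N * (1 + ∑ i, ∑ j ∈ Finset.univ.erase i, ‖y i - y j‖⁻¹) ^ N :=
          mul_le_mul_of_nonneg_left hsum (by positivity)
  · -- Riemann sums → `S₁ 2 F`
    intro f F hF hF'
    set g : (Fin 2 → E4) → ℝ := fun y => f 0 (y 0) * f 1 (y 1) * K (y 0 - y 1) with hg
    obtain ⟨K', hK'⟩ := integrand_decay K C η hη hKb f F hF hF'
    have hlim := tendsto_riemannSum_piBox (n := 2) (p := 9) (by norm_num) g hK'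
      (integrand_continuousAt_ae K hKc f) sch.a sch.L sch.a_pos sch.tendsto_a sch.tendsto_L
    -- identify the Riemann sums
    have hsum : ∀ k, (sch.a k ^ 4) ^ 2 *
        ∑ x ∈ Fintype.piFinset (fun _ : Fin 2 => box 4 (sch.L k)),
          (∏ i, f i (sch.a k • siteToE (x i))) * K (sch.a k • siteToE (x 0) - sch.a k • siteToE (x 1)) =
        (sch.a k ^ 4) ^ 2 *
          ∑ x ∈ Fintype.piFinset (fun _ : Fin 2 => box 4 (sch.L k)), g (fun i => sch.a k • siteToE (x i)) := by
      intro k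
      congr 1
      refine Finset.sum_congr rfl fun x _ => ?_
      rw [Fin.prod_univ_two]
    -- identify the limit
    have hint : ((∫ z, g z : ℝ) : ℂ) = S₁ 2 F := by
      rw [(hrep F hF').2, ← integral_complex_ofReal]
      refine integral_congr_ae (ae_of_all _ fun z => ?_)
      show ((g z : ℝ) : ℂ) = (K (z 0 - z 1) : ℂ) * F z
      rw [hF z, Fin.prod_univ_two]
      simp only [hg, ofRealTest_apply]
      push_cast
      ring
    rw [← hint]
    simp only [hsum]
    exact (Complex.continuous_ofReal.tendsto _).comp hlim

end DegreeTwo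

end Summit.QuantumFields.YangMills.Theorems.SoftKernelBoostCovariance.Sketch

end
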